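import Literature.NumberTheory.EllipticCurves.IwasawaSelmerSupersingularLocalProofs
import Literature.NumberTheory.EllipticCurves.VariableChangePointsMap
import Literature.NumberTheory.EllipticCurves.SelmerCorankProofs
import Literature.NumberTheory.EllipticCurves.LocalTorsionUnramifiedProofs
import Literature.NumberTheory.EllipticCurves.LocalPointsIntegersSubgroup
import Literature.NumberTheory.EllipticCurves.SelmerFiniteProofs
import HarnessLib

/-!
# Rational `p`-power torsion misses the kernel of reduction at `v ∣ p`, `p ≥ 3` (Silverman VII.3.1 with IV.6.1)

For an elliptic curve `E/K` over a number field, a finite place `v ∣ p` with `p ≥ 3` at which `K_v` is absolutely unramified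
(`‖z‖ < 1 ⇒ ‖z‖ ≤ ‖p‖` on `K_v`, e.g. `K = ℚ`), and a `K`-rational point `P`: if `P` is `p`-power torsion and its image in
`E(K̄_v)` lies in the kernel of reduction `E₁(K̄_v) = W.localKernelOfReduction v` (the tree's `E₁`, defined through the chosen
minimal model at `v`), then `P = O`. In the tree's Galois-module vocabulary (`t1_of_hdisc`, `t1_of_odd`): every `Γ_K`-fixed
`p`-power-torsion point of `W.geomPoints` mapping into `W.localKernelOfReduction v` is `0` — the hypothesis (T₁) of the `H46`
kernel programme (`Summits/…/ByReductionTypeAtTwoTorsionEulerCharH46OfT1`), discharged for every odd `p` over `ℚ`.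

Proof. The transport of the image of `(x₀, y₀) ∈ E(K)` to the minimal model at `v` is the `K_v`-RATIONAL point
`(u⁻²(x₀ − r), …)` of that model (`one_lt_norm_toX_of_mem_localKernelOfReduction`: functoriality of the change of variables in the
field of definition, `VariableChange.pointEquivBaseChange_map`), so `E₁`-membership reads `‖x'‖ > 1` for its `x`-coordinate; the minimal
model is `v`-integral, and a `K_v`-rational `p`-torsion point of the kernel of reduction of an integral model over an absolutely
unramified `p`-adic field with `p ≥ 3` is `O` (`UnramifiedKernelTorsion.eq_zero_of_prime_nsmul_eq_zero_of_mem_kernel`, Silverman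
IV.6.1/VII.3.1); `p`-power torsion reduces to `p`-torsion by induction, and `Γ_K`-fixed points of `E(K̄)` are rational
(`mem_range_toGeomPoints_iff`). For `K = ℚ` the unramifiedness input is `norm_le_norm_natCast_of_norm_lt_one_rat` (`p` is a
uniformiser of `ℚ_p`). THEOREMS ONLY. [cite: SilvermanAEC2009, Prop. VII.3.1, Thm. IV.6.1, Prop. VII.2.2]
-/

noncomputable section

open scoped Classical NumberField
open NumberField IsDedekindDomain Field WeierstrassCurve Literature.NumberTheory.EllipticCurves
  Literature.NumberTheory.GaloisRepresentations

namespace Literature.NumberTheory.EllipticCurves.RationalTorsionKernelOfReduction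

variable {K : Type} [Field K] [NumberField K] (W : WeierstrassCurve K) [W.IsElliptic] (v : HeightOneSpectrum (𝓞 K))

/-- Two affine points with equal coordinates are equal (private plumbing). [folklore] -/
private theorem some_eq_some' {F : Type*} [Field F] {X : WeierstrassCurve F} {x x' y y' : F}
    {h : X.toAffine.Nonsingular x y} {h' : X.toAffine.Nonsingular x' y'} (hx : x = x') (hy : y = y') :
    (Affine.Point.some x y h : X.toAffine.Point) = Affine.Point.some x' y' h' := by
  subst hx hy; rfl

omit [W.IsElliptic] in
/-- **`E₁`-membership in coordinates on the minimal model.** If the image in `E(K̄_v)` of the rational affine point `(x₀, y₀)` lies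
in `E₁(K̄_v) = W.localKernelOfReduction v`, then the `x`-coordinate `x' = u⁻²(x₀ − r) ∈ K_v` of its transport to the chosen minimal
model at `v` has `‖x'‖ > 1`. [cite: SilvermanAEC2009, Prop. VII.2.2] -/
theorem one_lt_norm_toX_of_mem_localKernelOfReduction {x₀ y₀ : K} (h : W.toAffine.Nonsingular x₀ y₀)
    (hE : pointsMap W (v.adicCompletion K) (toGeomPoints W (.some x₀ y₀ h)) ∈ W.localKernelOfReduction v) :
    1 < ‖((((W.baseChange (v.adicCompletion K)).exists_isMinimal (v.adicCompletionIntegers K)).choose).map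
        (algebraMap (v.adicCompletion K) (v.adicCompletion K))).toX (algebraMap K (v.adicCompletion K) x₀)‖ := by
  set C := ((W.baseChange (v.adicCompletion K)).exists_isMinimal (v.adicCompletionIntegers K)).choose with hC
  -- the `K_v`-rational point `P₁ = (x₀, y₀)` of `W_{K_v}` and its transport `Q₁` to the minimal model
  let P₁ : ((W.baseChange (v.adicCompletion K)).baseChange (v.adicCompletion K)).toAffine.Point :=
    Affine.Point.map (W' := W) (Algebra.ofId K (v.adicCompletion K)) (.some x₀ y₀ h)
  have hns : ((W.baseChange (v.adicCompletion K)).baseChange (v.adicCompletion K)).toAffine.Nonsingular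
      (algebraMap K (v.adicCompletion K) x₀) (algebraMap K (v.adicCompletion K) y₀) :=
    (W.toAffine.baseChange_nonsingular (f := Algebra.ofId K (v.adicCompletion K))
      (algebraMap K (v.adicCompletion K)).injective x₀ y₀).mpr h
  have hQ₁ := VariableChange.pointEquivBaseChange_some (W.baseChange (v.adicCompletion K)) C (v.adicCompletion K)
    (x := algebraMap K (v.adicCompletion K) x₀) (y := algebraMap K (v.adicCompletion K) y₀) hns
  have hmap := Affine.Point.map_some (W' := W.baseChange (v.adicCompletion K))
    (Algebra.ofId (v.adicCompletion K) (AlgebraicClosure (v.adicCompletion K))) hns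
  have hP₁ : P₁ = Affine.Point.some (algebraMap K (v.adicCompletion K) x₀) (algebraMap K (v.adicCompletion K) y₀) hns := rfl
  -- the model point is the image of `Q₁` in `K̄_v`
  have hloc : Affine.Point.congrEquiv (baseChange_baseChange_adicCompletion W v).symm
      (W.localPointsEquivPoint _ (pointsMap W (v.adicCompletion K) (toGeomPoints W (.some x₀ y₀ h)))) =
      Affine.Point.map (W' := W.baseChange (v.adicCompletion K))
        (Algebra.ofId (v.adicCompletion K) (AlgebraicClosure (v.adicCompletion K))) P₁ := by
    rw [hP₁, hmap, localPointsEquivPoint_apply]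
    change Affine.Point.congrEquiv _ (Affine.Point.some
      (closureEmb (K := K) (v.adicCompletion K) (algebraMap K (AlgebraicClosure K) x₀))
      (closureEmb (K := K) (v.adicCompletion K) (algebraMap K (AlgebraicClosure K) y₀)) _) = _
    rw [Affine.Point.congrEquiv_some]
    exact some_eq_some' (by rw [AlgHom.commutes, Algebra.ofId_apply, ← IsScalarTower.algebraMap_apply])
      (by rw [AlgHom.commutes, Algebra.ofId_apply, ← IsScalarTower.algebraMap_apply])
  obtain ⟨hh, hmodel⟩ : ∃ hh, W.localPointsEquivModel v (pointsMap W (v.adicCompletion K) (toGeomPoints W (.some x₀ y₀ h))) =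
      Affine.Point.some
        (algebraMap (v.adicCompletion K) (AlgebraicClosure (v.adicCompletion K))
          ((C.map (algebraMap (v.adicCompletion K) (v.adicCompletion K))).toX (algebraMap K (v.adicCompletion K) x₀)))
        (algebraMap (v.adicCompletion K) (AlgebraicClosure (v.adicCompletion K))
          ((C.map (algebraMap (v.adicCompletion K) (v.adicCompletion K))).toY (algebraMap K (v.adicCompletion K) x₀)
            (algebraMap K (v.adicCompletion K) y₀))) hh :=
    ⟨_, by
      rw [localPointsEquivModel_apply, hloc, ← VariableChange.pointEquivBaseChange_map, hP₁, hQ₁]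
      erw [Affine.Point.map_some, Affine.Point.congrEquiv_some]
      rfl⟩
  have hiff := W.mem_localKernelOfReduction_iff_of_eq_some v hmodel
  have h1 : 1 < v.spectralValuation (algebraMap (v.adicCompletion K) (AlgebraicClosure (v.adicCompletion K))
      ((C.map (algebraMap (v.adicCompletion K) (v.adicCompletion K))).toX (algebraMap K (v.adicCompletion K) x₀))) :=
    hiff.mp hE
  rw [← NNReal.coe_lt_coe, NNReal.coe_one, HeightOneSpectrum.coe_spectralValuation_algebraMap (v.coe_spectralValuation)] at h1
  exact h1

/-- **No non-zero `K`-rational `p`-torsion point maps into `E₁(K̄_v)`** for `p ≥ 3` and `v ∣ p` with `‖z‖ < 1 ⇒ ‖z‖ ≤ ‖p‖` on `K_v`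
(absolutely unramified): the formal group of the `v`-integral minimal model has no `K_v`-rational `p`-torsion.
[cite: SilvermanAEC2009, Prop. VII.3.1, Thm. IV.6.1] -/
theorem false_of_mem_localKernelOfReduction_of_prime_nsmul_eq_zero {p : ℕ} [hp : Fact p.Prime] (hp3 : 3 ≤ p)
    (hpv : ((p : ℕ) : 𝓞 K) ∈ v.asIdeal)
    (hdisc : ∀ z : v.adicCompletion K, ‖z‖ < 1 → ‖z‖ ≤ ‖((p : ℕ) : v.adicCompletion K)‖)
    {x₀ y₀ : K} (h : W.toAffine.Nonsingular x₀ y₀)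
    (hE : pointsMap W (v.adicCompletion K) (toGeomPoints W (.some x₀ y₀ h)) ∈ W.localKernelOfReduction v)
    (hpP : p • (Affine.Point.some x₀ y₀ h : W.toAffine.Point) = 0) : False := by
  have hx := one_lt_norm_toX_of_mem_localKernelOfReduction W v h hE
  set C := ((W.baseChange (v.adicCompletion K)).exists_isMinimal (v.adicCompletionIntegers K)).choose with hC
  let P₁ : ((W.baseChange (v.adicCompletion K)).baseChange (v.adicCompletion K)).toAffine.Point :=
    Affine.Point.map (W' := W) (Algebra.ofId K (v.adicCompletion K)) (.some x₀ y₀ h)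
  have hns : ((W.baseChange (v.adicCompletion K)).baseChange (v.adicCompletion K)).toAffine.Nonsingular
      (algebraMap K (v.adicCompletion K) x₀) (algebraMap K (v.adicCompletion K) y₀) :=
    (W.toAffine.baseChange_nonsingular (f := Algebra.ofId K (v.adicCompletion K))
      (algebraMap K (v.adicCompletion K)).injective x₀ y₀).mpr h
  have hP₁ : P₁ = Affine.Point.some (algebraMap K (v.adicCompletion K) x₀) (algebraMap K (v.adicCompletion K) y₀) hns := rfl
  have hQ₁ := VariableChange.pointEquivBaseChange_some (W.baseChange (v.adicCompletion K)) C (v.adicCompletion K)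
    (x := algebraMap K (v.adicCompletion K) x₀) (y := algebraMap K (v.adicCompletion K) y₀) hns
  -- `p • Q₁ = 0`
  have hpP₁ : p • P₁ = 0 :=
    (map_nsmul (Affine.Point.map (W' := W) (Algebra.ofId K (v.adicCompletion K))) p _).symm.trans
      ((congrArg (Affine.Point.map (W' := W) (Algebra.ofId K (v.adicCompletion K))) hpP).trans (map_zero _))
  have hpQ : p • VariableChange.pointEquivBaseChange (W.baseChange (v.adicCompletion K)) C (v.adicCompletion K) P₁ = 0 := by
    rw [← map_nsmul, hpP₁, map_zero]
  -- the integrality of the minimal model for the norm valuation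
  haveI hint : ((C • W.baseChange (v.adicCompletion K)).baseChange (v.adicCompletion K)).IsIntegral
      (NormedField.valuation : Valuation (v.adicCompletion K) NNReal).integer := by
    rw [hC, W.smul_baseChange_eq_map_localMinimalIntegralModel v]
    have e : ((W.localMinimalIntegralModel v).map (algebraMap (v.adicCompletionIntegers K)
        (v.adicCompletion K))).baseChange (v.adicCompletion K) =
        (W.localMinimalIntegralModel v).baseChange (v.adicCompletion K) := by
      change ((W.localMinimalIntegralModel v).map _).map (algebraMap (v.adicCompletion K) (v.adicCompletion K)) =
        (W.localMinimalIntegralModel v).map _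
      rw [Algebra.algebraMap_self, WeierstrassCurve.map_id]
    rw [e]
    exact LocalPoints.isIntegral_baseChange v (W.localMinimalIntegralModel v)
  -- the kernel membership of `Q₁`
  have hker : VariableChange.pointEquivBaseChange (W.baseChange (v.adicCompletion K)) C (v.adicCompletion K) P₁ ∈
      FormalGroupChart.kernel (NormedField.valuation : Valuation (v.adicCompletion K) NNReal)
        ((C • W.baseChange (v.adicCompletion K)).baseChange (v.adicCompletion K)) := by
    intro x y hxy he
    rw [hP₁, hQ₁] at he
    simp only [Affine.Point.some.injEq] at he
    rw [← he.1, LocalPoints.valuation_apply, ← NNReal.coe_lt_coe, coe_nnnorm, NNReal.coe_one]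
    exact hx
  -- the formal group: `Q₁ = 0`, contradiction
  have hp0 : ((p : ℕ) : v.adicCompletion K) ≠ 0 := by
    rw [← map_natCast (algebraMap K (v.adicCompletion K)) p]
    exact (_root_.map_ne_zero _).mpr (Nat.cast_ne_zero.mpr hp.out.ne_zero)
  have hp1 : ‖((p : ℕ) : v.adicCompletion K)‖ < 1 := by
    have h := LocalPoints.valuation_natCast_lt_one v hpv (p := p)
    rw [LocalPoints.valuation_apply, ← NNReal.coe_lt_coe, coe_nnnorm, NNReal.coe_one] at h
    exact h
  letI : NontriviallyNormedField (v.adicCompletion K) :=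
    NontriviallyNormedField.ofNormNeOne ⟨((p : ℕ) : v.adicCompletion K), hp0, hp1.ne⟩
  have h0 := UnramifiedKernelTorsion.eq_zero_of_prime_nsmul_eq_zero_of_mem_kernel
    ((C • W.baseChange (v.adicCompletion K)).baseChange (v.adicCompletion K)) hp3 hp0 hp1 hdisc _ hker hpQ
  rw [hP₁, hQ₁] at h0
  exact Affine.Point.some_ne_zero _ h0

/-- **`p` is a uniformiser of `ℚ_p`**: `‖z‖ < 1 ⇒ ‖z‖ ≤ ‖p‖` on the completion of `ℚ` at the place above `p` (the valuation of `ℚ_p` is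
discrete with `v(p) = 1`). [cite: SerreLocalFields1979, Ch. II §5 (the valuation of `ℚ_p`)] [cite: NeukirchANT1999, Ch. II (2.3)–(2.4)] -/
theorem norm_le_norm_natCast_of_norm_lt_one_rat {p : ℕ} [hp : Fact p.Prime] (vp : HeightOneSpectrum (𝓞 ℚ))
    (hvp : ((p : ℕ) : 𝓞 ℚ) ∈ vp.asIdeal) (z : vp.adicCompletion ℚ) (hz : ‖z‖ < 1) :
    ‖z‖ ≤ ‖((p : ℕ) : vp.adicCompletion ℚ)‖ := by
  have hgen : Rat.HeightOneSpectrum.natGenerator vp = p := Rat.HeightOneSpectrum.primesEquiv_eq_of_natCast_mem vp hp.out hvp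
  have hideal : vp.asIdeal = Ideal.span {((p : ℕ) : 𝓞 ℚ)} := by
    have h1 := Rat.HeightOneSpectrum.span_natGenerator vp
    rw [hgen] at h1
    have h2 : vp.asIdeal = (Ideal.span {((p : ℕ) : ℤ)}).comap (Rat.IsIntegralClosure.intEquiv (𝓞 ℚ)) := by
      rw [h1, Ideal.comap_map_of_bijective _ (Rat.IsIntegralClosure.intEquiv (𝓞 ℚ)).bijective]
    rw [h2]
    ext x
    rw [Ideal.mem_comap, Ideal.mem_span_singleton, Ideal.mem_span_singleton,
      ← map_natCast (Rat.IsIntegralClosure.intEquiv (𝓞 ℚ)) p, map_dvd_iff]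
  have hpval : Valued.v ((p : ℕ) : vp.adicCompletion ℚ) = WithZero.exp (-1 : ℤ) := by
    rw [← map_natCast (algebraMap (𝓞 ℚ) (vp.adicCompletion ℚ)) p]
    erw [HeightOneSpectrum.valuedAdicCompletion_eq_valuation]
    rw [HeightOneSpectrum.valuation_of_algebraMap]
    exact vp.intValuation_singleton (by exact_mod_cast hp.out.ne_zero) hideal
  rw [Valued.toNormedField.norm_lt_one_iff] at hz
  rw [Valued.toNormedField.norm_le_iff, hpval]
  by_cases h0 : Valued.v z = 0
  · rw [h0]; exact bot_le
  · rw [← WithZero.exp_log h0] at hz ⊢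
    rw [← WithZero.exp_zero, WithZero.exp_lt_exp] at hz
    exact WithZero.exp_le_exp.2 (by omega)

/-- **(T₁) for `p ≥ 3` at an absolutely unramified `v ∣ p`** (general number field; `‖z‖ < 1 ⇒ ‖z‖ ≤ ‖p‖` on `K_v`): every
`Γ_K`-fixed `p`-power-torsion point of `E(K̄)` whose image lies in `E₁(K̄_v)` is `0`. [cite: SilvermanAEC2009, Prop. VII.3.1, Thm. IV.6.1] -/
theorem t1_of_hdisc {p : ℕ} [hp : Fact p.Prime] (hp3 : 3 ≤ p) (hpv : ((p : ℕ) : 𝓞 K) ∈ v.asIdeal)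
    (hdisc : ∀ z : v.adicCompletion K, ‖z‖ < 1 → ‖z‖ ≤ ‖((p : ℕ) : v.adicCompletion K)‖) :
    ∀ P : W.geomPoints, (∀ σ : absoluteGaloisGroup K, σ • P = P) → (∃ t : ℕ, p ^ t • P = 0) →
      pointsMap W (v.adicCompletion K) P ∈ W.localKernelOfReduction v → P = 0 := by
  -- order `p` first
  have key : ∀ P : W.geomPoints, (∀ σ : absoluteGaloisGroup K, σ • P = P) → p • P = 0 →
      pointsMap W (v.adicCompletion K) P ∈ W.localKernelOfReduction v → P = 0 := by
    intro P hfix hpP hE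
    obtain ⟨P₀, rfl⟩ := (W.mem_range_toGeomPoints_iff P).2 (MulAction.mem_fixedPoints.2 hfix)
    rcases P₀ with _ | ⟨x₀, y₀, h⟩
    · exact (toGeomPoints W).map_zero
    · exact (false_of_mem_localKernelOfReduction_of_prime_nsmul_eq_zero W v hp3 hpv hdisc h hE
        (toGeomPoints_injective W (((toGeomPoints W).map_nsmul p _).trans
          (hpP.trans (toGeomPoints W).map_zero.symm)))).elim
  intro P hfix ⟨t, ht⟩ hE
  induction t generalizing P with
  | zero => simpa using ht
  | succ t ih =>
    have hsm : ∀ (σ : absoluteGaloisGroup K) (n : ℕ) (x : W.geomPoints), σ • (n • x) = n • (σ • x) :=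
      fun σ n x ↦ map_nsmul (DistribSMul.toAddMonoidHom W.geomPoints σ) n x
    have ht' : p ^ t • (p • P) = 0 := by rw [← mul_nsmul', ← pow_succ]; exact ht
    have hpP : p • P = 0 :=
      ih (p • P) (fun σ ↦ by rw [hsm, hfix]) ht' (by rw [map_nsmul]; exact AddSubgroup.nsmul_mem _ hE _)
    exact key P hfix hpP hE

/-- **(T₁) over `ℚ` for every prime `p ≥ 3`**: `E(ℚ)[p^∞] ∩ E₁(ℚ̄_p) = 0` in the tree's currency — the hypothesis `hT1` of
`Summits/…/ByReductionTypeAtTwoTorsionEulerCharH46OfT1`. [cite: SilvermanAEC2009, Prop. VII.3.1, Thm. IV.6.1] -/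
theorem t1_of_odd (W : WeierstrassCurve ℚ) [W.IsElliptic] {p : ℕ} [hp : Fact p.Prime] (hp3 : 3 ≤ p)
    (vp : HeightOneSpectrum (𝓞 ℚ)) (hvp : ((p : ℕ) : 𝓞 ℚ) ∈ vp.asIdeal) :
    ∀ P : W.geomPoints, (∀ σ : absoluteGaloisGroup ℚ, σ • P = P) → (∃ t : ℕ, p ^ t • P = 0) →
      pointsMap W (vp.adicCompletion ℚ) P ∈ W.localKernelOfReduction vp → P = 0 :=
  t1_of_hdisc W vp hp3 hvp (norm_le_norm_natCast_of_norm_lt_one_rat vp hvp)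

end Literature.NumberTheory.EllipticCurves.RationalTorsionKernelOfReduction

end
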